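import Summits.QuantumFields.YangMills.Theorems.UnitScaleTiltHalvingP1FlatCoreWindowSizes
import Literature.MathematicalPhysics.QuantumFieldTheory.Balaban1983to89.B8Eq140Level
import Literature.MathematicalPhysics.QuantumFieldTheory.Balaban1983to89.B8Ineq132
import Literature.MathematicalPhysics.QuantumFieldTheory.Balaban1983to89.B8ScaledSupNorm
import HarnessLib

/-!
# `hP1room` PROGRAMME (LEAD-H BOARD v1 (R4) ∕ ★w3-20520 g6 (A-1) STAGE 2, row (s-1)): ★★ THE BRIDGE FROM N05's OUTPUT SIZE LETTERS — print's (1.36)₁ «`|A′| ≤ c⋆(Lʲη)⁻¹`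
# on the sides touching `Ω_j`» and (1.36)₂ «`(Lʲη)²|∇^η A′| ≤ c⋆`» ([Balaban1985RegularSpaces] Thm 2 ∕ Thm 4, tree: ✓`B8Thm2GaugeFixedKLevel.thm2_exists_gaugeFixed_kLevel`,
# ✓`B8Thm4Concrete.thm4Body_concrete`) — TO THE LEVEL-CUBE SIZES (hX1)∕(hX2) OF ✓`HalvingP1FlatCoreWindowSizes.hsize_of_windowSizes`, AND THE ONE-CALL `hsize` SUPPLIER

Route `UnitScaleTilt`, crux K1 child «MinimiserStabilityRegPr» (stmt-QuantumFields-19200), registered stub `stub_halvingStep` (`BirthV10`), text `hP1room ⟸ hSupU`.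
Cell `ym3-torus` (HUMAN RULING D-0037: YM₃ on T³ is ladder rung R3 — NOT d = 4, NOT a mass gap, NOT the Clay problem), width seat `ym-ust-19200-w6` gen 2.
`--supports stmt-QuantumFields-19200 --as helper`; THEOREMS ONLY (0 `def`, 0 `sorry`); count-neutral; nothing here claims `core′`, `hP1room`, `hSupU`, the stub, the crux or the gap.

WHAT.
* §1 (any `ℤᵈ`, any seminormed group of values) ★`levelCubeSup_of_sideTouches` — from `‖X y τ‖ ≤ c·(Lʲη)⁻¹` on `SideTouches (Ω j)` and `cube … j ⊆ Ω j` (`d ≥ 2`):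
  `(Lʲη)·‖X z ν‖ ≤ c` on `□_j^{N05}`; ★`levelCubeGrad_of_sideTouches` — from `(Lʲη)²·‖covDerivFwd η 1 ν′ (X · ν) z‖ ≤ c` on `SideTouches (Ω j)`:
  `(Lʲη)²·η⁻¹·‖X (z + e_{ν′}) ν − X z ν‖ ≤ c` on `□_j^{N05}` (flat background: `conjR 1 = id`); ★`levelCubeSup_of_msup` ∕ ★`levelCubeGrad_of_msup` — the same two
  rows from print's WEIGHTED NORMS `|X|₍₋₁₎ ≤ c`, `|∇^ηX|₍₋₂₎ ≤ c` (the `msup` letters of ✓`B8Prop3KLevel.prop3_norms_kLevel` ∕ ✓`B8Thm2GaugeFixedKLevel`, `Bdd` displayed).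
* §2 (the H-line member, `η := L^{−(K−n)}`, `M₂(ℂ)`) ★★`hsize_of_sideTouchesSizes` — the door's `hsize` binder (✓p638875 :128–137, `B₁ε₀ := c`) in ONE call from N05's two pointwise
  size letters + `cube … j ⊆ Ω j` (✓`hsize_of_windowSizes` inside; `η⁻¹ = L^{K−n}` by `inv_pow`∕`inv_inv`).
HONEST SCOPE.  Letter bookkeeping; no analysis; the sizes themselves are N05's (Theorems 2∕4 of [Balaban1985RegularSpaces], sockets displayed there).

References: T. Bałaban, CMP **99** (1985) 75–102 [Balaban1985RegularSpaces] (Thm 2 p.83, (1.36) p.82, p.77 (sides touching `Ω_j`), p.86 (the weighted norms));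
CMP **102** (1985) 277–309 [Balaban1985Variational] ((152) p.301, p.286).
-/

set_option autoImplicit false

noncomputable section

open scoped BigOperators Matrix.Norms.L2Operator

namespace Summit.QuantumFields.YangMills.Theorems.HalvingP1FlatCoreWindowSizesOfSideTouches

open Literature.MathematicalPhysics.QuantumFieldTheory.Balaban1983to89
open Literature.MathematicalPhysics.QuantumFieldTheory.Balaban1983to89.T3ContinuumYM3Torus
open B5Eq118OneStroke (iterBlockOf)
open B7Prop1Explicit renaming Site → LSite
open B7Prop1Explicit (e)
open B7Eq78Linearization (conjR)
open B8Eq131Cubes (cube gs)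
open B8Ineq132 (BondTouches covDerivFwd)
open B8Eq140Level (SideTouches sideTouches_of_bondTouches)
open B8ScaledSupNorm (msup Bdd weight weight_mul_norm_le_msup weight_neg_natCast)
open B10Eq27TorusAxialLog (rel)
open B15Eq112TorusCover (lift)
open FlatCubeOpsText (IsLevWeight)
open FlatCubeSequenceAligned (cubeSeqMT3 cubeSetM)
open HalvingP1FlatCoreWindowSizes (hsize_of_windowSizes)

/-! ## §1 From the sides touching `Ω_j` to the level cubes -/

section Generic

variable {d : ℕ} {E : Type*} [SeminormedAddCommGroup E]

/-- A site of `S` carries bonds that are sides of plaquettes touching `S` (`d ≥ 2`; ✓`B8Eq140Level.sideTouches_of_bondTouches`).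
[cite: Balaban1985RegularSpaces, p.77 (convention before (1.5))] -/
theorem sideTouches_of_mem (hd2 : 2 ≤ d) {S : Set (LSite d)} {y : LSite d} (hy : y ∈ S) (τ : Fin d) : SideTouches S y τ := by
  haveI : Nontrivial (Fin d) := Fin.nontrivial_iff_two_le.mpr hd2
  obtain ⟨κ, hκ⟩ := exists_ne τ
  exact sideTouches_of_bondTouches hκ (Or.inl hy)

/-- ★ **(1.36)₁ ON THE SIDES TOUCHING `Ω_j` ⟹ THE SUP ROW (hX1) ON THE LEVEL CUBES**: if `‖X y τ‖ ≤ c·(Lʲη)⁻¹` whenever `SideTouches (Ω j) y τ` (`j ≤ k`) and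
`□_j := cube L a M′ ρ′ k j ⊆ Ω j`, then `(Lʲη)·‖X z ν‖ ≤ c` on `□_j` (`η > 0`, `L ≥ 1`, `d ≥ 2`). [cite: Balaban1985RegularSpaces, (1.36) p.82, Thm 2 p.83] -/
theorem levelCubeSup_of_sideTouches (hd2 : 2 ≤ d) {L k : ℕ} (hL : 1 ≤ L) {η : ℝ} (hη : 0 < η) {a : LSite d} {M' ρ' : ℕ}
    (Ω : ℕ → Set (LSite d)) (hΩ : ∀ j, j ≤ k → cube L a M' ρ' k j ⊆ Ω j) (X : LSite d → Fin d → E) {c : ℝ}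
    (hsup : ∀ j, j ≤ k → ∀ (y : LSite d) (τ : Fin d), SideTouches (Ω j) y τ → ‖X y τ‖ ≤ c * ((L : ℝ) ^ j * η)⁻¹) :
    ∀ j, j ≤ k → ∀ z ∈ cube L a M' ρ' k j, ∀ ν : Fin d, (L : ℝ) ^ j * η * ‖X z ν‖ ≤ c := by
  intro j hj z hz ν
  have hw : 0 < (L : ℝ) ^ j * η := by
    have : (0 : ℝ) < L := by exact_mod_cast hL
    positivity
  have h := hsup j hj z ν (sideTouches_of_mem hd2 (hΩ j hj hz) ν)
  calc (L : ℝ) ^ j * η * ‖X z ν‖ ≤ (L : ℝ) ^ j * η * (c * ((L : ℝ) ^ j * η)⁻¹) := mul_le_mul_of_nonneg_left h hw.le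
    _ = c := by field_simp

/-- ★ **(1.36)₂ ON THE SIDES TOUCHING `Ω_j` ⟹ THE GRADIENT ROW (hX2) ON THE LEVEL CUBES**: at the flat background, `covDerivFwd η 1 ν′ f z = η⁻¹·(f (z + e_{ν′}) − f z)`; so
`(Lʲη)²·‖covDerivFwd η 1 ν′ (X · ν) z‖ ≤ c` whenever `SideTouches (Ω j) z ν` gives `(Lʲη)²·η⁻¹·‖X (z + e_{ν′}) ν − X z ν‖ ≤ c` on `□_j ⊆ Ω j`.
[cite: Balaban1985RegularSpaces, (1.36) p.82, Thm 2 p.83, p.86] -/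
theorem levelCubeGrad_of_sideTouches {𝔸 : Type*} [NormedRing 𝔸] [NormedAlgebra ℂ 𝔸]
    (hd2 : 2 ≤ d) {L k : ℕ} {η : ℝ} (hη : 0 < η) {a : LSite d} {M' ρ' : ℕ}
    (Ω : ℕ → Set (LSite d)) (hΩ : ∀ j, j ≤ k → cube L a M' ρ' k j ⊆ Ω j) (X : LSite d → Fin d → 𝔸) {c : ℝ}
    (hgrad : ∀ j, j ≤ k → ∀ (z : LSite d) (ν ν' : Fin d), SideTouches (Ω j) z ν →
      ((L : ℝ) ^ j * η) ^ 2 * ‖covDerivFwd η (1 : LSite d → Fin d → 𝔸ˣ) ν' (fun x => X x ν) z‖ ≤ c) :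
    ∀ j, j ≤ k → ∀ z ∈ cube L a M' ρ' k j, ∀ ν ν' : Fin d,
      ((L : ℝ) ^ j * η) ^ 2 * η⁻¹ * ‖X (z + e ν') ν - X z ν‖ ≤ c := by
  intro j hj z hz ν ν'
  have h := hgrad j hj z ν ν' (sideTouches_of_mem hd2 (hΩ j hj hz) ν)
  have hcd : covDerivFwd η (1 : LSite d → Fin d → 𝔸ˣ) ν' (fun x => X x ν) z = η⁻¹ • (X (z + e ν') ν - X z ν) := by
    simp only [covDerivFwd, Pi.one_apply, B7Eq78Linearization.conjR_apply, Units.val_one, inv_one, one_mul, mul_one]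
  rw [hcd, norm_smul, Real.norm_of_nonneg (inv_nonneg.2 hη.le), ← mul_assoc] at h
  exact h

/-- ★ **THE SAME FROM PRINT's WEIGHTED NORM `|X|₍₋₁₎ ≤ c`** (the `msup` letter of ✓`B8Prop3KLevel.prop3_norms_kLevel` ∕ ✓`B8Thm2GaugeFixedKLevel`, over the sides touching `Ω_j`;
`Bdd` = the p. 86 boundedness side condition of the real `iSup`, e.g. from any crude pointwise bound by ✓`B8ScaledSupNorm.bdd_of_forall`): `(Lʲη)·‖X z ν‖ ≤ c` on `□_j ⊆ Ω j`.
[cite: Balaban1985RegularSpaces, (1.36) p.82, (1.62) p.87, p.86 (definition after (1.55))] -/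
theorem levelCubeSup_of_msup (hd2 : 2 ≤ d) {L k : ℕ} {η : ℝ} {a : LSite d} {M' ρ' : ℕ}
    (Ω : ℕ → Set (LSite d)) (hΩ : ∀ j, j ≤ k → cube L a M' ρ' k j ⊆ Ω j) (X : LSite d → Fin d → E) {c : ℝ}
    (hB : Bdd L k η (-(1 : ℝ)) (fun j (b : LSite d × Fin d) => SideTouches (Ω j) b.1 b.2) (fun b => X b.1 b.2))
    (hm : msup L k η (-(1 : ℝ)) (fun j (b : LSite d × Fin d) => SideTouches (Ω j) b.1 b.2) (fun b => X b.1 b.2) ≤ c) :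
    ∀ j, j ≤ k → ∀ z ∈ cube L a M' ρ' k j, ∀ ν : Fin d, (L : ℝ) ^ j * η * ‖X z ν‖ ≤ c := by
  intro j hj z hz ν
  have h := (weight_mul_norm_le_msup hB hj (i := (z, ν)) (sideTouches_of_mem hd2 (hΩ j hj hz) ν)).trans hm
  have hw : weight L η (-(1 : ℝ)) j = (L : ℝ) ^ j * η := by
    rw [show (-(1 : ℝ)) = -((1 : ℕ) : ℝ) by norm_num, weight_neg_natCast, pow_one]
  rwa [hw] at h

/-- ★ **THE GRADIENT ROW FROM PRINT's WEIGHTED NORM `|∇^η X|₍₋₂₎ ≤ c`** (the `msup … (−2)` letter of ✓`B8Prop3KLevel.prop3_norms_kLevel` ∕ ✓`B8Thm2GaugeFixedKLevel` over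
`t = (ν′, ν, z)` with `SideTouches (Ω j) z ν`, flat background; `Bdd` displayed): `(Lʲη)²·η⁻¹·‖X (z + e_{ν′}) ν − X z ν‖ ≤ c` on `□_j ⊆ Ω j`.
[cite: Balaban1985RegularSpaces, (1.36) p.82, (1.62) p.87, p.86 (definition after (1.55))] -/
theorem levelCubeGrad_of_msup {𝔸 : Type*} [NormedRing 𝔸] [NormedAlgebra ℂ 𝔸]
    (hd2 : 2 ≤ d) {L k : ℕ} {η : ℝ} (hη : 0 < η) {a : LSite d} {M' ρ' : ℕ}
    (Ω : ℕ → Set (LSite d)) (hΩ : ∀ j, j ≤ k → cube L a M' ρ' k j ⊆ Ω j) (X : LSite d → Fin d → 𝔸) {c : ℝ}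
    (hB : Bdd L k η (-(2 : ℝ)) (fun j (t : Fin d × Fin d × LSite d) => SideTouches (Ω j) t.2.2 t.2.1)
      (fun t => covDerivFwd η (1 : LSite d → Fin d → 𝔸ˣ) t.1 (fun z => X z t.2.1) t.2.2))
    (hm : msup L k η (-(2 : ℝ)) (fun j (t : Fin d × Fin d × LSite d) => SideTouches (Ω j) t.2.2 t.2.1)
      (fun t => covDerivFwd η (1 : LSite d → Fin d → 𝔸ˣ) t.1 (fun z => X z t.2.1) t.2.2) ≤ c) :
    ∀ j, j ≤ k → ∀ z ∈ cube L a M' ρ' k j, ∀ ν ν' : Fin d,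
      ((L : ℝ) ^ j * η) ^ 2 * η⁻¹ * ‖X (z + e ν') ν - X z ν‖ ≤ c := by
  refine levelCubeGrad_of_sideTouches hd2 hη Ω hΩ X fun j hj z ν ν' hzν => ?_
  have h := (weight_mul_norm_le_msup hB hj (i := (ν', ν, z)) hzν).trans hm
  have hw : weight L η (-(2 : ℝ)) j = ((L : ℝ) ^ j * η) ^ 2 := by
    rw [show (-(2 : ℝ)) = -((2 : ℕ) : ℝ) by norm_num, weight_neg_natCast]
  rwa [hw] at h

end Generic

/-! ## §2 The one-call `hsize` supplier at the H-line member -/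

variable {F : T3Family} {n K : ℕ}

open Classical in
/-- ★★ **THE DOOR's `hsize` BINDER IN ONE CALL FROM N05's TWO POINTWISE SIZE LETTERS** (`η := L^{−(K−n)}`, values in `M₂(ℂ)`): given J1b's window letters, a family
`Ω j ⊇ cube (F.P K).L a M′ ρ′ (K−n) j` (N05's domains at the member), and for the `ℤ³` one-form `X` the (1.36)₁ row `‖X y τ‖ ≤ c·(Lʲη)⁻¹` and the (1.36)₂ row
`(Lʲη)²·‖covDerivFwd η 1 ν′ (X · ν) z‖ ≤ c` on the sides touching `Ω j` (`0 ≤ c`), the two (iii) rows of ✓`HalvingP1FlatCoreChartDataDoor.mlogChartDataMult_of_suppliers`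
(:128–137) hold with `B₁ε₀ := c` — §1 ∘ ✓`HalvingP1FlatCoreWindowSizes.hsize_of_windowSizes`.
[cite: Balaban1985RegularSpaces, Thm 2 p.83, (1.36) p.82, (1.131) p.99; Balaban1985Variational, (144) p.300, (152) p.301, p.286] -/
theorem hsize_of_sideTouchesSizes (hnK : n < K) (x₀ : Site (F.P K) 0) (ρ S M : ℕ) (hM : 1 ≤ M) (hS : 2 ≤ S)
    {a : LSite (F.P K).d} {M' ρ' : ℕ} (h0 : ρ + M ≤ ρ' + 1) (h1 : (F.P K).L + S + M ≤ ρ' + 2)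
    (ha : ∀ ν, a ν ≤ ((iterBlockOf (K - n) x₀ ν).val : ℤ) ∧ ((iterBlockOf (K - n) x₀ ν).val : ℤ) ≤ a ν + M' - 1)
    (hroomW : 2 * ((F.P K).L ^ (K - n) * (M' + 1) + ρ' * gs (F.P K).L (K - n)) ≤ (F.P K).sitesPerDir 0)
    (Ω : ℕ → Set (LSite (F.P K).d)) (hΩ : ∀ j, j ≤ K - n → cube (F.P K).L a M' ρ' (K - n) j ⊆ Ω j)
    (X : LSite (F.P K).d → Fin (F.P K).d → Matrix (Fin 2) (Fin 2) ℂ) {c : ℝ} (hc : 0 ≤ c)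
    (hsup : ∀ j, j ≤ K - n → ∀ (y : LSite (F.P K).d) (τ : Fin (F.P K).d), SideTouches (Ω j) y τ →
      ‖X y τ‖ ≤ c * (((F.P K).L : ℝ) ^ j * ((F.L : ℝ)⁻¹) ^ (K - n))⁻¹)
    (hgrad : ∀ j, j ≤ K - n → ∀ (z : LSite (F.P K).d) (ν ν' : Fin (F.P K).d), SideTouches (Ω j) z ν →
      (((F.P K).L : ℝ) ^ j * ((F.L : ℝ)⁻¹) ^ (K - n)) ^ 2 *
        ‖covDerivFwd (((F.L : ℝ)⁻¹) ^ (K - n)) (1 : LSite (F.P K).d → Fin (F.P K).d → (Matrix (Fin 2) (Fin 2) ℂ)ˣ) ν' (fun x => X x ν) z‖ ≤ c) :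
    ∀ wt : ℕ → PBond (F.P K) 0 → ℝ, IsLevWeight F n K (cubeSeqMT3 F n K x₀ ρ S M hM) wt →
      (∀ b : PBond (F.P K) 0, wt 1 b *
        ‖(fun b : PBond (F.P K) 0 => if b.src ∈ cubeSetM x₀ (K - n) ρ S M 0 ∧ b.tgt ∈ cubeSetM x₀ (K - n) ρ S M 0 then
          X (lift (F.P K) x₀ + rel x₀ b.src) b.dir else 0) b‖ ≤ c) ∧
      (∀ (b : PBond (F.P K) 0) (ν' : Fin (F.P K).d), wt 2 b * (F.L : ℝ) ^ (K - n) *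
        ‖(fun b : PBond (F.P K) 0 => if b.src ∈ cubeSetM x₀ (K - n) ρ S M 0 ∧ b.tgt ∈ cubeSetM x₀ (K - n) ρ S M 0 then
            X (lift (F.P K) x₀ + rel x₀ b.src) b.dir else 0) ⟨b.src.shift ν', b.dir⟩ -
          (fun b : PBond (F.P K) 0 => if b.src ∈ cubeSetM x₀ (K - n) ρ S M 0 ∧ b.tgt ∈ cubeSetM x₀ (K - n) ρ S M 0 then
            X (lift (F.P K) x₀ + rel x₀ b.src) b.dir else 0) b‖ ≤ c) := by
  have hd2 : 2 ≤ (F.P K).d := by rw [T3Family.P_d]; norm_num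
  have hL1 : 1 ≤ (F.P K).L := (F.P K).L_pos
  have hL0 : (0 : ℝ) < F.L := by exact_mod_cast (F.P K).L_pos
  have hη : (0 : ℝ) < ((F.L : ℝ)⁻¹) ^ (K - n) := by positivity
  have hFL : ((F.P K).L : ℝ) = (F.L : ℝ) := rfl
  have hX1 := levelCubeSup_of_sideTouches hd2 hL1 hη Ω hΩ X hsup
  have hX2 := levelCubeGrad_of_sideTouches hd2 hη Ω hΩ X hgrad
  refine hsize_of_windowSizes hnK x₀ ρ S M hM hS h0 h1 ha hroomW X hc (fun j hj z hz ν => ?_) (fun j hj z hz ν ν' _ => ?_)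
  · have h := hX1 j hj z hz ν
    rwa [hFL] at h
  · have h := hX2 j hj z hz ν ν'
    rwa [hFL, inv_pow, inv_inv, ← inv_pow] at h

end Summit.QuantumFields.YangMills.Theorems.HalvingP1FlatCoreWindowSizesOfSideTouches

end
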